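import Mathlib.MeasureTheory.Constructions.Polish.Basic
import Mathlib.MeasureTheory.Measure.WithDensity
import HarnessLib

/-!
# Reduction of a tube identity `ν(Φ(A₀ × V)) = κ(V)` from a π-system of windows to all Borel `V ⊆ U`
(Harish-Chandra 1970, Lemma 22 (the Jacobian of the conjugation map, read locally); Weil 1965, n° 49;
the measure theory is Dynkin's π–λ uniqueness, Mathlib `ext_on_measurableSpace_of_generate_finite`)

Topic `MeasureTheory/Measure`; namespace `Literature.MeasureTheory.Measure`. THEOREMS ONLY (no definition,
no instance, no notation, no named fact, no `sorry`); Mathlib-only imports.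

THE SITUATION (carrier-free). `Φ : X × Y → Z` is a map of measurable spaces (in the application: `X = G ⧸ T`,
`Y = T` a Cartan subgroup, `Z = G`, `Φ(xT, t) = x t x⁻¹` the conjugation family), `ν` a measure on `Z` (Haar),
`κ` a measure on `Y` (the candidate radial density `μ₀(A₀) · D · tm`), `A₀ ⊆ X` and `U ⊆ Y` an open
"neighbourhood of a regular point" on which `Φ` restricted to `A₀ × U` is a measurable embedding (it is
continuous and injective there — chart injectivity — and `X × Y` is Polish: Lusin–Souslin,
`measurableEmbedding_restrict_of_continuousOn_injOn`). Then

* §3 `exists_measure_apply_eq_measure_image_prod` — **the left side is a measure**: there is a measure `λ` on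
  `Y` with `λ(V) = ν(Φ(A₀ × V))` for every measurable `V ⊆ U` (`λ = snd_* Φ|^* ν`, Mathlib `Measure.comap` along
  the embedding);
* §2 `measure_eq_of_piSystem_of_subset` — **uniqueness on `U`**: two measures on `Y`, the first finite on `U`,
  which agree on a π-system `𝒞` of measurable subsets of `U` containing `U` and generating (at least) the open
  subsets of `U`, agree on every measurable `V ⊆ U` (`ext_on_measurableSpace_of_generate_finite` for the
  restrictions to `U`; Borel traces on `U` lie in `σ(𝒞)`, §1);
* §4 the heads **`measure_image_prod_eq_of_piSystem`** (abstract embedding), **`…_of_basis`** (the π-system is a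
  family of OPEN subsets of `U` through which every open `O ⊆ U` is locally refined — e.g. the nested-or-disjoint
  clopen cosets `t · T_j` of a congruence filtration, `isPiSystem_of_subset_or_disjoint`; `Y` second countable)
  and **`…_of_basis_of_continuousOn_injOn`** (Polish `X`, `Y`; `Φ` continuous and injective on `A₀ × U`):
  if `ν(Φ(A₀ × C)) = κ(C)` for all `C ∈ 𝒞` (and `ν(Φ(A₀ × U)) < ∞`), then **`ν(Φ(A₀ × V)) = κ(V)` for every
  measurable `V ⊆ U`**.

Purpose (HCML F0, crux H413 = `stmt-HodgeConjecture-24833`, LH6 organ (S-𝔇), ROAD «JAC-ELL» (LH5-p02 (g6)) brick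
(Q4) «COSET REDUCTION AT `T = Z(γ₀)`», memo v1 §2 (7)): the local tube-Jacobian socket `hJacLoc` of ★
`F0P3cStCharTSWeylCartanJacobian.lintegral_cartanSet_eq_of_tubeJacobian_local` asks the tube identity for all
measurable (regular, `W`-free) `V ⊆ U`; the Cayley-window computation (C8b) delivers it on the cosets
`t₀ · c(Y₀ + 𝔱_j)`; this file is the bridge. The split-torus twin with the radial measure supplied by a Weil
factorisation instead of chart injectivity is ★ `F0P3cStCharTSWeylHypTubeReduction` (LH6-p04 (g6)); §1 here is
its §1 restated generically (a `Literature` file cannot import `Summits`).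

## References
* [HarishChandra1970] Harish-Chandra (notes by G. van Dijk), *Harmonic analysis on reductive p-adic groups*,
  LNM 162 (1970), Part V §4 Lemma 22.
* [Weil1965] A. Weil, *Sur la formule de Siegel dans la théorie des groupes classiques*, Acta Math. 113 (1965),
  n° 49 Lemme 22 (p. 70).
* [Rogawski1990] J. D. Rogawski, *Automorphic Representations of Unitary Groups in Three Variables* (1990),
  §12.5 p. 182 (Weyl integration formula).
* [Kechris1995] A. S. Kechris, *Classical Descriptive Set Theory*, GTM 156 (1995), §10.A Thm. 10.1 (π–λ),
  §11.B (Borel sets), Thm. 15.1 (Lusin–Souslin: injective continuous images of Borel sets are Borel).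
-/

set_option autoImplicit false

noncomputable section

open MeasureTheory MeasureTheory.Measure Set Filter Topology Function MeasurableSpace
open scoped ENNReal NNReal

namespace Literature.MeasureTheory.Measure

/-! ## §1 Borel traces on an open `U` lie in any σ-algebra containing the open subsets of `U` -/

section Traces

variable {α : Type*} [TopologicalSpace α]

omit [TopologicalSpace α] in
/-- **A nested-or-disjoint family is a π-system**: if any two members of `𝒞` are nested or disjoint then `𝒞` is
stable under non-empty intersections (the intersection is the smaller member). [cite: Kechris1995, §10.A Thm. 10.1 (π–λ)] -/
theorem isPiSystem_of_subset_or_disjoint (𝒞 : Set (Set α))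
    (hnd : ∀ C ∈ 𝒞, ∀ D ∈ 𝒞, C ⊆ D ∨ D ⊆ C ∨ Disjoint C D) : IsPiSystem 𝒞 := by
  intro C hC D hD hne
  rcases hnd C hC D hD with h | h | h
  · rwa [inter_eq_left.2 h]
  · rwa [inter_eq_right.2 h]
  · exact absurd (h.inter_eq ▸ hne) Set.not_nonempty_empty

variable [MeasurableSpace α] [BorelSpace α]

/-- **Borel traces on `U` are generated by a family generating the open subsets of `U`**: if every open
`O ⊆ U` (in particular `U`) is measurable for the σ-algebra generated by `𝒞`, then so is `B ∩ U` for every Borel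
`B` (induction over open ∕ complement ∕ countable union, `MeasurableSet.induction_on_open`).
[cite: Kechris1995, §11.B (Borel sets: the σ-algebra generated by the open sets)] -/
theorem measurableSet_generateFrom_inter_of_open {U : Set α} (hUo : IsOpen U) (𝒞 : Set (Set α))
    (hopen : ∀ O : Set α, IsOpen O → O ⊆ U → MeasurableSet[generateFrom 𝒞] O)
    {B : Set α} (hB : MeasurableSet B) : MeasurableSet[generateFrom 𝒞] (B ∩ U) := by
  induction B, hB using MeasurableSet.induction_on_open with
  | isOpen O hO => exact hopen (O ∩ U) (hO.inter hUo) inter_subset_right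
  | compl B hB ih =>
    have hU : MeasurableSet[generateFrom 𝒞] U := hopen U hUo subset_rfl
    have heq : Bᶜ ∩ U = U \ (B ∩ U) := by
      ext x
      constructor
      · rintro ⟨hx, hxU⟩
        exact ⟨hxU, fun h => hx h.1⟩
      · rintro ⟨hxU, hx⟩
        exact ⟨fun h => hx ⟨h, hxU⟩, hxU⟩
    rw [heq]
    exact hU.diff ih
  | iUnion f _ hf ih =>
    rw [iUnion_inter]
    exact MeasurableSet.iUnion ih

omit [MeasurableSpace α] [BorelSpace α] in
/-- **Basis form ⇒ open form**: in a second countable space, if `𝒞` consists of open sets and every open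
`O ⊆ U` is refined through `𝒞` at each of its points (`∀ y ∈ O, ∃ C ∈ 𝒞, y ∈ C ⊆ O`), then every open `O ⊆ U`
is a countable union of members of `𝒞` (Lindelöf), hence measurable for `σ(𝒞)`.
[cite: Kechris1995, §11.B (Borel sets of a second countable space are generated by a countable basis)] -/
theorem measurableSet_generateFrom_of_isOpen_of_basis [SecondCountableTopology α] {U : Set α}
    (𝒞 : Set (Set α)) (h𝒞o : ∀ C ∈ 𝒞, IsOpen C)
    (hbasis : ∀ O : Set α, IsOpen O → O ⊆ U → ∀ y ∈ O, ∃ C ∈ 𝒞, y ∈ C ∧ C ⊆ O)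
    {O : Set α} (hO : IsOpen O) (hOU : O ⊆ U) :
    @MeasurableSet α (generateFrom 𝒞) O := by
  -- the members of `𝒞` inside `O` cover `O`
  set S : Set (Set α) := {C | C ∈ 𝒞 ∧ C ⊆ O} with hSdef
  have hSo : ∀ s ∈ S, IsOpen s := fun s hs => h𝒞o s hs.1
  obtain ⟨T, hTc, hTS, hTU⟩ := TopologicalSpace.isOpen_sUnion_countable S hSo
  have hSU : ⋃₀ S = O := by
    apply subset_antisymm
    · exact sUnion_subset fun s hs => hs.2
    · intro y hy
      obtain ⟨C, hC, hyC, hCO⟩ := hbasis O hO hOU y hy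
      exact ⟨C, ⟨hC, hCO⟩, hyC⟩
  rw [← hSU, ← hTU]
  exact MeasurableSet.sUnion hTc fun s hs => measurableSet_generateFrom (hTS hs).1

end Traces

/-! ## §2 Uniqueness on `U` from a π-system of subsets of `U` -/

section Unique

variable {α : Type*} [TopologicalSpace α] [MeasurableSpace α] [BorelSpace α]

/-- **Two measures agreeing on a generating π-system of windows agree on every Borel subset of the window**:
let `U` be open with `κ₁ U < ∞`, `𝒞` a π-system of measurable subsets of `U` with `U ∈ 𝒞` such that every open
`O ⊆ U` is `σ(𝒞)`-measurable; if `κ₁ = κ₂` on `𝒞` then `κ₁ V = κ₂ V` for every measurable `V ⊆ U`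
(`ext_on_measurableSpace_of_generate_finite` for `κᵢ|_U`, and `V = V ∩ U ∈ σ(𝒞)` by §1).
[cite: HarishChandra1970, Lemma 22] [cite: Weil1965, n° 49 Lemme 22 (p. 70)] -/
theorem measure_eq_of_piSystem_of_subset (κ₁ κ₂ : Measure α) {U : Set α} (hUo : IsOpen U)
    (hfin : κ₁ U ≠ ∞) (𝒞 : Set (Set α)) (hπ : IsPiSystem 𝒞) (hU𝒞 : U ∈ 𝒞)
    (h𝒞m : ∀ C ∈ 𝒞, MeasurableSet C) (h𝒞U : ∀ C ∈ 𝒞, C ⊆ U)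
    (hopen : ∀ O : Set α, IsOpen O → O ⊆ U → MeasurableSet[generateFrom 𝒞] O)
    (heq : ∀ C ∈ 𝒞, κ₁ C = κ₂ C) {V : Set α} (hV : MeasurableSet V) (hVU : V ⊆ U) :
    κ₁ V = κ₂ V := by
  haveI : IsFiniteMeasure (κ₁.restrict U) := ⟨by rwa [Measure.restrict_apply_univ, lt_top_iff_ne_top]⟩
  have hle : generateFrom 𝒞 ≤ (inferInstance : MeasurableSpace α) :=
    generateFrom_le fun C hC => h𝒞m C hC
  have hagree : ∀ s ∈ 𝒞, κ₁.restrict U s = κ₂.restrict U s := fun s hs => by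
    rw [Measure.restrict_apply (h𝒞m s hs), Measure.restrict_apply (h𝒞m s hs),
      inter_eq_left.2 (h𝒞U s hs), heq s hs]
  have huniv : κ₁.restrict U univ = κ₂.restrict U univ := by
    rw [Measure.restrict_apply_univ, Measure.restrict_apply_univ, heq U hU𝒞]
  have hVm : MeasurableSet[generateFrom 𝒞] V := by
    have := measurableSet_generateFrom_inter_of_open hUo 𝒞 hopen hV
    rwa [inter_eq_left.2 hVU] at this
  have key := ext_on_measurableSpace_of_generate_finite (inferInstance : MeasurableSpace α) 𝒞 hagree hle rfl hπ
    huniv hVm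
  rwa [Measure.restrict_apply hV, Measure.restrict_apply hV, inter_eq_left.2 hVU] at key

end Unique

/-! ## §3 The tube set function `V ↦ ν(Φ(A₀ × V))` is a measure -/

section Tube

variable {X Y Z : Type*} [MeasurableSpace X] [MeasurableSpace Y] [MeasurableSpace Z]

omit [MeasurableSpace X] [MeasurableSpace Y] [MeasurableSpace Z] in
/-- The slices of the window through the restricted map: for `V ⊆ U`,
`Φ|_{A₀ × U} '' {p | p.2 ∈ V} = Φ '' (A₀ × V)`. [cite: HarishChandra1970, Lemma 22] -/
theorem image_restrict_preimage_snd_eq (Φ : X × Y → Z) {A₀ : Set X} {U V : Set Y} (hVU : V ⊆ U) :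
    (A₀ ×ˢ U).restrict Φ '' {p : ↥(A₀ ×ˢ U) | ((p : X × Y)).2 ∈ V} = Φ '' (A₀ ×ˢ V) := by
  ext z
  constructor
  · rintro ⟨p, hp, rfl⟩
    exact ⟨(p : X × Y), ⟨p.2.1, hp⟩, rfl⟩
  · rintro ⟨q, hq, rfl⟩
    exact ⟨⟨q, ⟨hq.1, hVU hq.2⟩⟩, hq.2, rfl⟩

/-- **The tube set function is a measure**: if `Φ` restricted to `A₀ × U` is a measurable embedding then there is a
measure `λ` on `Y` with `λ(V) = ν(Φ(A₀ × V))` for every measurable `V ⊆ U` — namely the push-forward to the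
second factor of the pull-back `Φ|_{A₀ × U}^* ν` (Mathlib `Measure.comap`, `MeasurableEmbedding.comap_apply`).
[cite: HarishChandra1970, Lemma 22] -/
theorem exists_measure_apply_eq_measure_image_prod (Φ : X × Y → Z) (ν : Measure Z) {A₀ : Set X} {U : Set Y}
    (hΦ : MeasurableEmbedding ((A₀ ×ˢ U).restrict Φ)) :
    ∃ μ : Measure Y, ∀ V : Set Y, MeasurableSet V → V ⊆ U → μ V = ν (Φ '' (A₀ ×ˢ V)) := by
  refine ⟨(Measure.comap ((A₀ ×ˢ U).restrict Φ) ν).map (fun p : ↥(A₀ ×ˢ U) => ((p : X × Y)).2), ?_⟩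
  intro V hV hVU
  have hmeas : Measurable fun p : ↥(A₀ ×ˢ U) => ((p : X × Y)).2 :=
    measurable_snd.comp measurable_subtype_coe
  rw [Measure.map_apply hmeas hV, hΦ.comap_apply]
  exact congrArg ν (image_restrict_preimage_snd_eq Φ hVU)

/-- **Lusin–Souslin supplies the embedding**: on Polish `X`, `Y` (Borel σ-algebras) and Hausdorff `Z`, a map `Φ`
continuous and injective on the Borel window `A₀ × U` is a measurable embedding there (Mathlib
`ContinuousOn.measurableEmbedding`; `Z` Hausdorff with its Borel σ-algebra). [cite: Kechris1995, Thm. 15.1 (Lusin–Souslin)] -/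
theorem measurableEmbedding_restrict_of_continuousOn_injOn
    [TopologicalSpace X] [PolishSpace X] [BorelSpace X] [TopologicalSpace Y] [PolishSpace Y] [BorelSpace Y]
    [TopologicalSpace Z] [T2Space Z] [BorelSpace Z]
    (Φ : X × Y → Z) {A₀ : Set X} {U : Set Y} (hA₀ : MeasurableSet A₀) (hU : MeasurableSet U)
    (hΦc : ContinuousOn Φ (A₀ ×ˢ U)) (hinj : InjOn Φ (A₀ ×ˢ U)) :
    MeasurableEmbedding ((A₀ ×ˢ U).restrict Φ) :=
  hΦc.measurableEmbedding (hA₀.prod hU) hinj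

/-- Images of measurable sub-windows are measurable under the embedding hypothesis. [cite: Kechris1995, Thm. 15.1 (Lusin–Souslin)] -/
theorem measurableSet_image_prod_of_measurableEmbedding (Φ : X × Y → Z) {A₀ : Set X} {U : Set Y}
    (hΦ : MeasurableEmbedding ((A₀ ×ˢ U).restrict Φ)) {V : Set Y} (hV : MeasurableSet V) (hVU : V ⊆ U) :
    MeasurableSet (Φ '' (A₀ ×ˢ V)) := by
  rw [← image_restrict_preimage_snd_eq Φ hVU]
  exact hΦ.measurableSet_image' ((measurable_snd.comp measurable_subtype_coe) hV)

end Tube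

/-! ## §4 The heads: a tube identity on a π-system of windows holds on every Borel `V ⊆ U` -/

section Heads

variable {X Y Z : Type*} [MeasurableSpace X] [TopologicalSpace Y] [MeasurableSpace Y] [BorelSpace Y]
  [MeasurableSpace Z]

/-- **COSET REDUCTION, abstract form**: `Φ|_{A₀ × U}` a measurable embedding, `U` open with
`ν(Φ(A₀ × U)) < ∞`, `𝒞 ∋ U` a π-system of measurable subsets of `U` such that every open `O ⊆ U` is
`σ(𝒞)`-measurable; if `ν(Φ(A₀ × C)) = κ(C)` for all `C ∈ 𝒞` then `ν(Φ(A₀ × V)) = κ(V)` for every measurable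
`V ⊆ U`. [cite: HarishChandra1970, Lemma 22] [cite: Weil1965, n° 49 Lemme 22 (p. 70)] [cite: Rogawski1990, §12.5 p. 182] -/
theorem measure_image_prod_eq_of_piSystem (Φ : X × Y → Z) (ν : Measure Z) (κ : Measure Y) {A₀ : Set X}
    {U : Set Y} (hUo : IsOpen U) (hΦ : MeasurableEmbedding ((A₀ ×ˢ U).restrict Φ))
    (hfin : ν (Φ '' (A₀ ×ˢ U)) ≠ ∞) (𝒞 : Set (Set Y)) (hπ : IsPiSystem 𝒞) (hU𝒞 : U ∈ 𝒞)
    (h𝒞m : ∀ C ∈ 𝒞, MeasurableSet C) (h𝒞U : ∀ C ∈ 𝒞, C ⊆ U)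
    (hopen : ∀ O : Set Y, IsOpen O → O ⊆ U → MeasurableSet[generateFrom 𝒞] O)
    (heq : ∀ C ∈ 𝒞, ν (Φ '' (A₀ ×ˢ C)) = κ C) {V : Set Y} (hV : MeasurableSet V) (hVU : V ⊆ U) :
    ν (Φ '' (A₀ ×ˢ V)) = κ V := by
  obtain ⟨μ, hμ⟩ := exists_measure_apply_eq_measure_image_prod Φ ν hΦ
  rw [← hμ V hV hVU]
  refine measure_eq_of_piSystem_of_subset μ κ hUo ?_ 𝒞 hπ hU𝒞 h𝒞m h𝒞U hopen ?_ hV hVU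
  · rwa [hμ U hUo.measurableSet subset_rfl]
  · intro C hC
    rw [hμ C (h𝒞m C hC) (h𝒞U C hC), heq C hC]

/-- **COSET REDUCTION, basis form** (`Y` second countable): the same with `𝒞` a π-system of OPEN subsets of `U`,
`U ∈ 𝒞`, through which every open `O ⊆ U` is refined at each point (`∀ y ∈ O, ∃ C ∈ 𝒞, y ∈ C ⊆ O`) — e.g. the
nested-or-disjoint clopen cosets `t · T_j ⊆ U` of a neighbourhood basis of subgroups `T_j`
(`isPiSystem_of_subset_or_disjoint`). [cite: HarishChandra1970, Lemma 22] [cite: Rogawski1990, §12.5 p. 182] -/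
theorem measure_image_prod_eq_of_basis [SecondCountableTopology Y] (Φ : X × Y → Z) (ν : Measure Z)
    (κ : Measure Y) {A₀ : Set X} {U : Set Y} (hUo : IsOpen U) (hΦ : MeasurableEmbedding ((A₀ ×ˢ U).restrict Φ))
    (hfin : ν (Φ '' (A₀ ×ˢ U)) ≠ ∞) (𝒞 : Set (Set Y)) (hπ : IsPiSystem 𝒞) (hU𝒞 : U ∈ 𝒞)
    (h𝒞o : ∀ C ∈ 𝒞, IsOpen C) (h𝒞U : ∀ C ∈ 𝒞, C ⊆ U)
    (hbasis : ∀ O : Set Y, IsOpen O → O ⊆ U → ∀ y ∈ O, ∃ C ∈ 𝒞, y ∈ C ∧ C ⊆ O)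
    (heq : ∀ C ∈ 𝒞, ν (Φ '' (A₀ ×ˢ C)) = κ C) {V : Set Y} (hV : MeasurableSet V) (hVU : V ⊆ U) :
    ν (Φ '' (A₀ ×ˢ V)) = κ V :=
  measure_image_prod_eq_of_piSystem Φ ν κ hUo hΦ hfin 𝒞 hπ hU𝒞 (fun C hC => (h𝒞o C hC).measurableSet) h𝒞U
    (fun _ hO hOU => measurableSet_generateFrom_of_isOpen_of_basis 𝒞 h𝒞o hbasis hO hOU) heq hV hVU

/-- **COSET REDUCTION, basis form on Polish carriers** (`X`, `Y` Polish with their Borel σ-algebras, `Z` Hausdorff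
with its Borel σ-algebra; `Φ` continuous and injective on the Borel window `A₀ × U` — chart
injectivity): the tube identity on a refining π-system of open windows `𝒞 ∋ U` holds on every Borel `V ⊆ U`.
[cite: HarishChandra1970, Lemma 22] [cite: Rogawski1990, §12.5 p. 182] -/
theorem measure_image_prod_eq_of_basis_of_continuousOn_injOn
    [TopologicalSpace X] [PolishSpace X] [BorelSpace X] [PolishSpace Y]
    [TopologicalSpace Z] [T2Space Z] [BorelSpace Z]
    (Φ : X × Y → Z) (ν : Measure Z) (κ : Measure Y) {A₀ : Set X} (hA₀ : MeasurableSet A₀) {U : Set Y}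
    (hUo : IsOpen U) (hΦc : ContinuousOn Φ (A₀ ×ˢ U)) (hinj : InjOn Φ (A₀ ×ˢ U))
    (hfin : ν (Φ '' (A₀ ×ˢ U)) ≠ ∞) (𝒞 : Set (Set Y)) (hπ : IsPiSystem 𝒞) (hU𝒞 : U ∈ 𝒞)
    (h𝒞o : ∀ C ∈ 𝒞, IsOpen C) (h𝒞U : ∀ C ∈ 𝒞, C ⊆ U)
    (hbasis : ∀ O : Set Y, IsOpen O → O ⊆ U → ∀ y ∈ O, ∃ C ∈ 𝒞, y ∈ C ∧ C ⊆ O)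
    (heq : ∀ C ∈ 𝒞, ν (Φ '' (A₀ ×ˢ C)) = κ C) {V : Set Y} (hV : MeasurableSet V) (hVU : V ⊆ U) :
    ν (Φ '' (A₀ ×ˢ V)) = κ V :=
  haveI : SecondCountableTopology Y := PolishSpace.toSecondCountableTopology
  measure_image_prod_eq_of_basis Φ ν κ hUo
    (measurableEmbedding_restrict_of_continuousOn_injOn Φ hA₀ hUo.measurableSet hΦc hinj) hfin 𝒞 hπ hU𝒞 h𝒞o
    h𝒞U hbasis heq hV hVU

/-- **The socket shape**: under the hypotheses of the abstract form, with `κ = μ₀(A₀) · (D · tm)` written out —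
`ν(Φ(A₀ × C)) = a · ∫⁻_C D dtm` on the windows `C ∈ 𝒞` implies `ν(Φ(A₀ × V)) = a · ∫⁻_V D dtm` for every
measurable `V ⊆ U` (the conclusion of the local tube-Jacobian socket `hJacLoc`, `a = μ₀(A₀)`).
[cite: HarishChandra1970, Lemma 22] [cite: Rogawski1990, §12.5 p. 182] -/
theorem measure_image_prod_eq_mul_lintegral_of_piSystem (Φ : X × Y → Z) (ν : Measure Z) (tm : Measure Y)
    {D : Y → ℝ≥0∞} (a : ℝ≥0∞) {A₀ : Set X} {U : Set Y} (hUo : IsOpen U)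
    (hΦ : MeasurableEmbedding ((A₀ ×ˢ U).restrict Φ)) (hfin : ν (Φ '' (A₀ ×ˢ U)) ≠ ∞)
    (𝒞 : Set (Set Y)) (hπ : IsPiSystem 𝒞) (hU𝒞 : U ∈ 𝒞) (h𝒞m : ∀ C ∈ 𝒞, MeasurableSet C)
    (h𝒞U : ∀ C ∈ 𝒞, C ⊆ U) (hopen : ∀ O : Set Y, IsOpen O → O ⊆ U → MeasurableSet[generateFrom 𝒞] O)
    (heq : ∀ C ∈ 𝒞, ν (Φ '' (A₀ ×ˢ C)) = a * ∫⁻ t in C, D t ∂tm) {V : Set Y} (hV : MeasurableSet V)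
    (hVU : V ⊆ U) : ν (Φ '' (A₀ ×ˢ V)) = a * ∫⁻ t in V, D t ∂tm := by
  have key := measure_image_prod_eq_of_piSystem Φ ν (a • tm.withDensity D) hUo hΦ hfin 𝒞 hπ hU𝒞 h𝒞m h𝒞U
    hopen (fun C hC => by rw [heq C hC, Measure.smul_apply, withDensity_apply _ (h𝒞m C hC), smul_eq_mul]) hV hVU
  rw [key, Measure.smul_apply, withDensity_apply _ hV, smul_eq_mul]

end Heads

end Literature.MeasureTheory.Measure
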